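import Summits.QuantumFields.YangMills.Theorems.BalabanLadderUVSeamRecPolymerData
import Literature.MathematicalPhysics.QuantumLattice.LatticeGaugeDLRFreeEnergyProofs
import HarnessLib

/-!
# Crux `UVSeamRec` (stmt-QuantumFields-20043), slot `stub_ceilings`: the POLYMER DATA at level `0` — the chart returns the plain
# plaquette variable of `ℤ⁴`, so `largeFieldEvent` at `k = 0` is the wave-0 large-plaquette event

Helper file (`--kind proof --supports stmt-QuantumFields-20043 --as helper`) of the unit `ym-20043-tempered-d1`, sibling of
`…PolymerData.lean` (p531519).  A sanity certificate of the chart plumbing and the hook for ceilings-p2's PROVED `k = 0` instance of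
the polymer law (PL) (infvol-p3's `measureReal_forall_le_cellAction_le_pow`, wave-0 `plaquetteCost`): at level `0` Bałaban's `0`-fold
average is the identity, the chart torus has `2b` sites, its central plaquette sits at `(b−1)·𝟙` and the chart origin is `y − (b−1)·𝟙`,
so `blockField 𝔟 0 y μ ν η = 1 − reTr(U(∂p))` with `p` the plaquette of `ℤ⁴` based at `y` (`plaquetteHolonomyZd η y μ ν`), and on the
periodic lift of a torus configuration it is `1 − reTr` of the torus plaquette at `y mod (2L+1)`.  HONEST FRAMING: bookkeeping; nothing
of (a)/(PL)/E0′; not a gap, not Clay.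
-/

set_option autoImplicit false

noncomputable section

open MeasureTheory
open Literature.MathematicalPhysics.QuantumFieldTheory (GaugeConfig)
open Literature.MathematicalPhysics.QuantumFieldTheory.Balaban1983to89
open Literature.MathematicalPhysics.QuantumLattice (LGConfig torusLift plaquetteHolonomyZd)

namespace Summit.QuantumFields.YangMills.Cruxes.UVSeamRec.PolymerData

variable {N : ℕ} [NeZero N]

/-- `2 ≤ 2b` sites: the level-`0` chart torus has `2·b^{1+0−0} = 2b` sites per direction. -/
theorem chartParams_sitesPerDir_zero (𝔟 : BlockSize) : (chartParams 𝔟 0).sitesPerDir 0 = 2 * 𝔟.b := by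
  rw [chartParams_sitesPerDir]; simp

/-- The canonical representative of the central site coordinate `b − 1` of the level-`0` chart torus is `b − 1`. -/
theorem val_central_zero (𝔟 : BlockSize) :
    (((𝔟.b - 1 : ℕ) : ZMod ((chartParams 𝔟 0).sitesPerDir 0))).val = 𝔟.b - 1 := by
  rw [ZMod.val_natCast, chartParams_sitesPerDir_zero]
  have := 𝔟.one_le
  exact Nat.mod_eq_of_lt (by omega)

/-- … and that of its successor `(b − 1) + 1` is `b` (no wrap-around: `b < 2b`). -/
theorem val_central_zero_succ (𝔟 : BlockSize) :
    (((𝔟.b - 1 : ℕ) : ZMod ((chartParams 𝔟 0).sitesPerDir 0)) + 1).val = 𝔟.b := by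
  have h1 : ((𝔟.b - 1 : ℕ) : ZMod ((chartParams 𝔟 0).sitesPerDir 0)) + 1 =
      ((𝔟.b : ℕ) : ZMod ((chartParams 𝔟 0).sitesPerDir 0)) := by
    rw [Nat.cast_pred 𝔟.pos, sub_add_cancel]
  rw [h1, ZMod.val_natCast, chartParams_sitesPerDir_zero]
  have := 𝔟.one_le
  exact Nat.mod_eq_of_lt (by omega)

/-- The `ℤ⁴` site read by the level-`0` chart at the central torus site is the block index `y` itself. -/
theorem chartOrigin_zero_add_central (𝔟 : BlockSize) (y : Fin 4 → ℤ) :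
    (fun i => chartOrigin 𝔟 0 y i + ((((𝔟.b - 1 : ℕ) : ZMod ((chartParams 𝔟 0).sitesPerDir 0))).val : ℤ)) = y := by
  funext i
  rw [val_central_zero, chartOrigin]
  have := 𝔟.one_le
  push_cast [Nat.cast_sub this]
  ring

/-- … and at the central site shifted by `e_μ` it is `y + e_μ`. -/
theorem chartOrigin_zero_add_central_shift (𝔟 : BlockSize) (y : Fin 4 → ℤ) (μ : Fin 4) :
    (fun i => chartOrigin 𝔟 0 y i +
      (((Site.shift (P := chartParams 𝔟 0) (j := 0) (fun _ => ((𝔟.b - 1 : ℕ) : ZMod ((chartParams 𝔟 0).sitesPerDir 0))) μ) i).val : ℤ)) =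
      y + Pi.single μ 1 := by
  funext i
  by_cases hi : i = μ
  · subst hi
    simp only [Site.shift, Function.update_self, Pi.add_apply, Pi.single_eq_same]
    rw [val_central_zero_succ, chartOrigin]
    ring
  · simp only [Site.shift, Function.update_of_ne hi, Pi.add_apply, Pi.single_eq_of_ne hi, add_zero]
    rw [val_central_zero, chartOrigin]
    have := 𝔟.one_le
    push_cast [Nat.cast_sub this]
    ring

/-- **AT LEVEL `0` THE BLOCK-AVERAGED PLAQUETTE FIELD IS THE PLAIN PLAQUETTE FIELD OF `ℤ⁴`:**
`blockField 𝔟 0 y μ ν η = 1 − reTr (U(∂p))`, `p = (y; μ, ν)` (`Averaging.iter _ 0 = id`; the chart is centred at `y`). -/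
theorem blockField_zero (𝔟 : BlockSize) (y : Fin 4 → ℤ) (μ ν : Fin 4) (h : μ < ν)
    (η : LGConfig 4 (Matrix.specialUnitaryGroup (Fin N) ℂ)) :
    blockField (N := N) 𝔟 0 y μ ν h η = 1 - reTr (plaquetteHolonomyZd η y μ ν) := by
  unfold blockField blockAvgIter
  simp only [Averaging.iter, id]
  congr 2
  unfold GaugeField.plaqHol plaquetteHolonomyZd centralPlaq
  simp only [ofConfig_apply, chart_apply]
  rw [chartOrigin_zero_add_central, chartOrigin_zero_add_central_shift, chartOrigin_zero_add_central_shift]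

/-- **THE LEVEL-`0` LARGE-FIELD EVENT IS THE WAVE-0 LARGE-PLAQUETTE EVENT:** `η ∈ largeFieldEvent 𝔟 ε (0, y, μ<ν) ↔ ε ≤ 1 − reTr (U(∂p))`. -/
theorem mem_largeFieldEvent_zero_iff (𝔟 : BlockSize) (ε : ℝ) (y : Fin 4 → ℤ) (μ ν : Fin 4) (h : μ < ν)
    (η : LGConfig 4 (Matrix.specialUnitaryGroup (Fin N) ℂ)) :
    η ∈ largeFieldEvent (N := N) 𝔟 ε ⟨0, y, μ, ν, h⟩ ↔ ε ≤ 1 - reTr (plaquetteHolonomyZd η y μ ν) := by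
  show ε ≤ blockField (N := N) 𝔟 0 y μ ν h η ↔ _
  rw [blockField_zero]

/-- On the periodic lift of a configuration of the odd torus `(ℤ/(2L+1))⁴` the level-`0` event reads the TORUS plaquette at
`y mod (2L+1)` (the shape in which infvol-p3's `plaquetteCost`-rarity and ceilings-p2's `k = 0` instance of (PL) are stated). -/
theorem torusLift_mem_largeFieldEvent_zero_iff (𝔟 : BlockSize) (ε : ℝ) (y : Fin 4 → ℤ) (μ ν : Fin 4) (h : μ < ν) (L : ℕ)
    (U : GaugeConfig 4 (2 * L + 1) (Matrix.specialUnitaryGroup (Fin N) ℂ)) :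
    torusLift (2 * L + 1) U ∈ largeFieldEvent (N := N) 𝔟 ε ⟨0, y, μ, ν, h⟩ ↔
      ε ≤ 1 - reTr (Literature.MathematicalPhysics.QuantumFieldTheory.plaquetteHolonomy U
        (Literature.Probability.LatticeModels.Torus.proj (2 * L + 1) y) μ ν) := by
  rw [mem_largeFieldEvent_zero_iff, Literature.MathematicalPhysics.QuantumLattice.FreeEnergy.plaquetteHolonomyZd_torusLift]

end Summit.QuantumFields.YangMills.Cruxes.UVSeamRec.PolymerData

end
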